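import Mathlib
import HarnessLib
import Summits.Ventures.LatticeQCDFlow.Scaling.IdentityFlowAcceptanceCouplingMonotone

/-!
# LatticeQCDFlow / Scaling — strong-coupling law of the ACCEPTANCE of the untrained sampler:
# `(1 − acc(β))/β → ½·E|T − T′|` as `β → 0⁺` — the acceptance leaves `1` LINEARLY in the coupling,
# with slope half the Gini mean difference of the tilt statistic (Wilson: of the action)

HONEST FRAMING: exact (Metropolis-corrected) sampling algorithms for lattice gauge theory;
figures of merit are autocorrelation/cost numbers at stated couplings and volumes; no
continuum-physics claim.

Venture `LatticeQCDFlow` (cell pub-lqcd), topic `Scaling`; FANOUT row 3 (`s0-u1-a`, S0-B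
implementation A, GEN-17).  NEW WORK of the cell (one derivative), not a published result; NO
definition is introduced.  Row 3's `Scaling/IdentityFlowStrongCoupling` (GEN-16) gave the
strong-coupling laws of the two ENVELOPES of the untrained (identity-flow) exact sampler — ESS deficit
`1 − Z(β)²/Z(2β) ∼ Var(T)·β²` and ceiling deficit `1 − Z(β/2)²/Z(β) ∼ Var(T)·β²/4`, both SECOND
order.  This file computes the law of the ACCEPTANCE ITSELF and finds it FIRST order: the sandwich
`(8/9)·ESS ≤ acc ≤ Z(β/2)²/Z(β)` is slack at first order near `β = 0`, and the acceptance has a KINK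
at the point where proposal and target coincide whenever `E|T − T′| > 0` (the law on the left of `0`
is the law on the right for `−T`, which has the same Gini mean difference; only the right-sided law is
stated below).

Setting: a probability law `μ` (the proposal) and a measurable statistic `T` with exponential
moments `∫ e^{γT} dμ < ∞` for `|γ| < r` (some `r > 0`; LOCAL moments suffice, so a tilt family based
at an interior coupling of an unbounded action qualifies); `acc(β) = (∫∫ min(e^{βT x}, e^{βT y}) dμ dμ)
/∫ e^{βT} dμ` is the equilibrium acceptance of the exact sampler proposing from `μ` against
`e^{βT}μ/Z(β)` (`Scaling/TiltAcceptanceCouplingMonotone`, `q ≡ 1`).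

* §1 `integrable_exp_mul_min_prod`, `zero_mem_interior_integrableExpSet(_min)` (all exponential
  moments of `min(T, T′)` under `μ ⊗ μ`); **`integral_integral_min_exp_eq_mgf`** — for `β ≥ 0` the
  numerator is `mgf_{μ⊗μ}(min(T,T′))(β)`; `hasDerivAt_mgf_min_zero`, `hasDerivAt_mgf_zero_mean`
  (Mathlib's `hasDerivAt_mgf` at `0`); **`integral_min_prod_eq`** `E[min(T,T′)] = E[T] − ½E|T − T′|`;
  **`tiltIMH_one_sub_meanAccept_div_tendsto`** — `(1 − acc(β))/β → ½·∫∫|T x − T y| dμ dμ` as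
  `β → 0⁺` (quotient rule at `0` for the two mgfs, then the one-sided slope);
  `sq_integral_abs_sub_le_two_mul_variance`, **`half_integral_abs_sub_le_sqrt_variance`** — the
  slope is at most `√(Var_μ(T)/2)` (Cauchy–Schwarz on `μ ⊗ μ`), the square root of half of GEN-16's
  second-order ESS coefficient.
* §2 WILSON theory, every compact `G`, continuous `ρ`, `d`, `L`, reference probability law `μ`:
  **`wilsonIdentityFlow_one_sub_meanAccept_div_tendsto`** — `(1 − acc(β))/β → ½·∫∫|S(U) − S(U′)| dμ dμ`
  (the acceptance of `Scaling/WilsonIdentityFlowLaw`), and the product-Haar / `partitionFunction`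
  form **`wilsonIdentityFlow_one_sub_meanAccept_div_tendsto_haar`**.
* §3 the FACTORISED 2-d U(1) model of `Scaling/U1IdentityFlowVolumeLaw`, every finite plaquette set:
  `u1Uniform_isProbabilityMeasure` (`(2π)^{−V}•Lebesgue^{⊗V}` on `(0,2π]^V` is a probability law),
  `u1IdentityFlow_meanAccept_eq_uniform` (the tree's acceptance as a tilt acceptance under it),
  **`u1IdentityFlow_one_sub_meanAccept_div_tendsto`** —
  `(1 − acc_V(β))/β → ½·(2π)^{−2V}∫∫|Σᵢcos θᵢ − Σᵢcos θ′ᵢ| dθ dθ′`.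

Reading (value-free; no number of ours is computed or implied): at strong coupling the untrained
sampler's rejection rate grows LINEARLY in `β` with slope half the mean absolute action difference of
two independent proposals, while its ESS loss and the Bhattacharyya bound on its rejection grow only
quadratically — so near `β = 0` an acceptance column cannot be inferred from an ESS column to first
order, and the `8/9` floor / Bhattacharyya ceiling are not tight there.  NOT CLAIMED: the closed form
of the U(1) Gini constant; the next-order term; trained flows; any value at the cell's `(β, L)`;
nothing re-scored, SEALED.md untouched.
-/

noncomputable section

namespace Summit.Ventures.LatticeQCDFlow.Theory2

open MeasureTheory Real Set ProbabilityTheory Filter Topology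

/-! ## §1 General tilt families: the acceptance leaves `1` LINEARLY, with slope `−½·E|T − T′|` -/

section Tilt

variable {Ω : Type*} [MeasurableSpace Ω] {μ : Measure Ω} [IsProbabilityMeasure μ] {T : Ω → ℝ}
  (hTm : Measurable T) {r : ℝ} (hr : 0 < r)
  (hint : ∀ γ : ℝ, |γ| < r → Integrable (fun x => Real.exp (γ * T x)) μ)
include hTm hr hint

omit hr in
/-- Exponential moments of `min(T, T′)` under `μ ⊗ μ` for `|γ| < r` (`e^{γ min} ≤ e^{γT} + e^{γT′}`).
[folklore] -/
theorem integrable_exp_mul_min_prod {γ : ℝ} (hγ : |γ| < r) :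
    Integrable (fun z : Ω × Ω => Real.exp (γ * min (T z.1) (T z.2))) (μ.prod μ) := by
  refine (((hint γ hγ).comp_fst μ).add ((hint γ hγ).comp_snd μ)).mono' ?_ (ae_of_all _ fun z => ?_)
  · exact (Real.measurable_exp.comp (measurable_const.mul
      ((hTm.comp measurable_fst).min (hTm.comp measurable_snd)))).aestronglyMeasurable
  · rw [Real.norm_eq_abs, abs_of_nonneg (Real.exp_pos _).le]
    rcases min_choice (T z.1) (T z.2) with h | h <;> rw [h]
    · exact le_add_of_nonneg_right (Real.exp_pos _).le
    · exact le_add_of_nonneg_left (Real.exp_pos _).le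

omit [IsProbabilityMeasure μ] hTm in
/-- `0` is interior to the domain of the moment generating function of `T` (it contains `(−r, r)`).
[folklore] -/
theorem zero_mem_interior_integrableExpSet : (0 : ℝ) ∈ interior (integrableExpSet T μ) :=
  mem_interior_iff_mem_nhds.2 (Filter.mem_of_superset (Ioo_mem_nhds (neg_lt_zero.2 hr) hr)
    fun γ hγ => hint γ (abs_lt.2 hγ))

/-- `0` is interior to the domain of the moment generating function of `min(T, T′)`. [folklore] -/
theorem zero_mem_interior_integrableExpSet_min :
    (0 : ℝ) ∈ interior (integrableExpSet (fun z : Ω × Ω => min (T z.1) (T z.2)) (μ.prod μ)) :=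
  mem_interior_iff_mem_nhds.2 (Filter.mem_of_superset (Ioo_mem_nhds (neg_lt_zero.2 hr) hr)
    fun _ hγ => integrable_exp_mul_min_prod hTm hint (abs_lt.2 hγ))

omit hr in
/-- **For `0 ≤ β < r` the acceptance numerator is a moment generating function**:
`∫∫ min(e^{βT x}, e^{βT y}) dμ dμ = mgf_{μ⊗μ}(min(T, T′))(β)`. [ours] -/
theorem integral_integral_min_exp_eq_mgf {β : ℝ} (hβ : 0 ≤ β) (hβr : |β| < r) :
    ∫ x, ∫ y, min (Real.exp (β * T x)) (Real.exp (β * T y)) ∂μ ∂μ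
      = mgf (fun z : Ω × Ω => min (T z.1) (T z.2)) (μ.prod μ) β := by
  rw [mgf, integral_prod _ (integrable_exp_mul_min_prod hTm hint hβr)]
  refine integral_congr_ae (ae_of_all _ fun x => integral_congr_ae (ae_of_all _ fun y => ?_))
  have hmono : Monotone fun a : ℝ => Real.exp (β * a) := fun a b h =>
    Real.exp_le_exp.2 (mul_le_mul_of_nonneg_left h hβ)
  exact (hmono.map_min (a := T x) (b := T y)).symm

/-- `mgf_{μ⊗μ}(min(T,T′))` has derivative `E[min(T, T′)]` at `0`. [folklore] -/
theorem hasDerivAt_mgf_min_zero :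
    HasDerivAt (mgf (fun z : Ω × Ω => min (T z.1) (T z.2)) (μ.prod μ))
      (∫ z, min (T z.1) (T z.2) ∂(μ.prod μ)) 0 := by
  have h := hasDerivAt_mgf (zero_mem_interior_integrableExpSet_min hTm hr hint)
  simp only [zero_mul, Real.exp_zero, mul_one] at h
  exact h

omit [IsProbabilityMeasure μ] hTm in
/-- `mgf_μ(T)` has derivative `E[T]` at `0`. [folklore] -/
theorem hasDerivAt_mgf_zero_mean : HasDerivAt (mgf T μ) (∫ x, T x ∂μ) 0 := by
  have h := hasDerivAt_mgf (zero_mem_interior_integrableExpSet (μ := μ) hr hint)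
  simp only [zero_mul, Real.exp_zero, mul_one] at h
  exact h

omit hTm in
/-- **`E[min(T, T′)] = E[T] − ½·E|T − T′|`** (the Gini-mean-difference form of the mean of a
minimum of two i.i.d. copies). [folklore] -/
theorem integral_min_prod_eq :
    ∫ z, min (T z.1) (T z.2) ∂(μ.prod μ)
      = ∫ x, T x ∂μ - 1 / 2 * ∫ x, ∫ y, |T x - T y| ∂μ ∂μ := by
  have hTi : Integrable T μ :=
    integrable_of_mem_interior_integrableExpSet (zero_mem_interior_integrableExpSet (μ := μ) hr hint)
  have h1 : Integrable (fun z : Ω × Ω => T z.1) (μ.prod μ) := hTi.comp_fst μ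
  have h2 : Integrable (fun z : Ω × Ω => T z.2) (μ.prod μ) := hTi.comp_snd μ
  have hD : Integrable (fun z : Ω × Ω => |T z.1 - T z.2|) (μ.prod μ) := (h1.sub h2).abs
  have hmin : ∀ a b : ℝ, min a b = (a + b) / 2 - |a - b| / 2 := fun a b => by
    rcases le_total a b with h | h
    · rw [min_eq_left h, abs_of_nonpos (sub_nonpos.2 h)]; ring
    · rw [min_eq_right h, abs_of_nonneg (sub_nonneg.2 h)]; ring
  have e : (fun z : Ω × Ω => min (T z.1) (T z.2))
      = fun z => (T z.1 + T z.2) / 2 - |T z.1 - T z.2| / 2 := funext fun z => hmin _ _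
  have hA : Integrable (fun z : Ω × Ω => (T z.1 + T z.2) / 2) (μ.prod μ) := (h1.add h2).div_const 2
  have hB : Integrable (fun z : Ω × Ω => |T z.1 - T z.2| / 2) (μ.prod μ) := hD.div_const 2
  rw [e, integral_sub hA hB, integral_div, integral_div, integral_add h1 h2,
    integral_fun_fst (fun x => T x), integral_fun_snd (fun x => T x), probReal_univ, one_smul,
    integral_prod _ hD]
  ring

/-- **STRONG-COUPLING LAW OF THE ACCEPTANCE.**  For a probability law `μ` and a measurable
statistic `T` with the exponential moments `|γ| < r`, the acceptance
`acc(β) = (∫∫ min(e^{βT x}, e^{βT y}) dμ dμ)/∫ e^{βT} dμ` of `μ`-proposals against the tilt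
`e^{βT}μ/Z(β)` satisfies `(1 − acc(β))/β → ½·∫∫ |T(x) − T(y)| dμ dμ` as `β → 0⁺` — the acceptance
leaves `1` LINEARLY in the coupling, with slope half the GINI MEAN DIFFERENCE of the statistic under
the proposal law (whereas the ESS `Z(β)²/Z(2β)` and the ceiling `Z(β/2)²/Z(β)` leave `1`
quadratically, `Scaling/IdentityFlowStrongCoupling`).  Proof: for `β ≥ 0` the numerator is the mgf
of `min(T, T′)` under `μ ⊗ μ`; differentiate the quotient of the two mgfs at `0` (Mathlib's
`hasDerivAt_mgf`) and use `E[min(T,T′)] − E[T] = −½E|T − T′|`. [ours] -/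
theorem tiltIMH_one_sub_meanAccept_div_tendsto :
    Tendsto (fun β : ℝ =>
      (1 - (∫ x, ∫ y, min (Real.exp (β * T x)) (Real.exp (β * T y)) ∂μ ∂μ)
        / ∫ x, Real.exp (β * T x) ∂μ) / β)
      (𝓝[>] 0) (𝓝 (1 / 2 * ∫ x, ∫ y, |T x - T y| ∂μ ∂μ)) := by
  have hfd := hasDerivAt_mgf_min_zero hTm hr hint
  have hgd := hasDerivAt_mgf_zero_mean (μ := μ) hr hint
  have hf0 : mgf (fun z : Ω × Ω => min (T z.1) (T z.2)) (μ.prod μ) 0 = 1 := mgf_zero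
  have hg0 : mgf T μ 0 = 1 := mgf_zero
  have hq := hfd.fun_div hgd (by rw [hg0]; exact one_ne_zero)
  rw [hf0, hg0] at hq
  simp only [one_pow, div_one, mul_one, one_mul] at hq
  -- `hq : HasDerivAt (mgf min / mgf T) (E min − E T) 0`
  have ht := hq.tendsto_slope_zero_right
  simp only [zero_add, hf0, hg0, div_one, smul_eq_mul] at ht
  have hlim : ∫ z, min (T z.1) (T z.2) ∂(μ.prod μ) - ∫ x, T x ∂μ
      = -(1 / 2 * ∫ x, ∫ y, |T x - T y| ∂μ ∂μ) := by
    rw [integral_min_prod_eq (μ := μ) hr hint]; ring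
  rw [hlim] at ht
  have ht' := ht.neg
  rw [neg_neg] at ht'
  have hev : ∀ᶠ β in 𝓝[>] (0 : ℝ), β ∈ Ioo 0 r := Ioo_mem_nhdsGT hr
  refine ht'.congr' (hev.mono fun β hβ => ?_)
  have hβ0 : 0 ≤ β := le_of_lt hβ.1
  have hβr : |β| < r := abs_lt.2 ⟨by linarith [hβ.1], hβ.2⟩
  have hgβ : ∫ x, Real.exp (β * T x) ∂μ = mgf T μ β := by rw [mgf]
  beta_reduce
  rw [integral_integral_min_exp_eq_mgf hTm hint hβ0 hβr, hgβ]
  have hβne : β ≠ 0 := ne_of_gt hβ.1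
  field_simp
  ring

omit hTm in
/-- **The slope is at most `√(Var(T)/2)`**: `(∫∫|T x − T y| dμ dμ)² ≤ 2·Var_μ(T)` (Cauchy–Schwarz on
`μ ⊗ μ`: `(E|T−T′|)² ≤ E(T−T′)² = 2 Var T`).  So the FIRST-order coefficient `½E|T−T′|` of the
acceptance deficit is at most `√(Var_μ(T)/2)`, the square root of half of GEN-16's SECOND-order ESS
coefficient `Var_μ(T)` (`Scaling/IdentityFlowStrongCoupling`). [ours] -/
theorem sq_integral_abs_sub_le_two_mul_variance :
    (∫ x, ∫ y, |T x - T y| ∂μ ∂μ) ^ 2 ≤ 2 * variance T μ := by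
  have hT2 : MemLp T 2 μ :=
    memLp_of_mem_interior_integrableExpSet (zero_mem_interior_integrableExpSet (μ := μ) hr hint) 2
  have hTi : Integrable T μ := hT2.integrable one_le_two
  have h1 : MemLp (fun z : Ω × Ω => T z.1) 2 (μ.prod μ) := hT2.comp_fst μ
  have h2 : MemLp (fun z : Ω × Ω => T z.2) 2 (μ.prod μ) := hT2.comp_snd μ
  have hD2 : MemLp (fun z : Ω × Ω => |T z.1 - T z.2|) 2 (μ.prod μ) := (h1.sub h2).abs
  have hDi : Integrable (fun z : Ω × Ω => |T z.1 - T z.2|) (μ.prod μ) := hD2.integrable one_le_two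
  -- `(E|D|)² ≤ E D²`
  have hvar := variance_nonneg (fun z : Ω × Ω => |T z.1 - T z.2|) (μ.prod μ)
  rw [variance_eq_sub hD2] at hvar
  have hsq : ∫ z, (fun z : Ω × Ω => |T z.1 - T z.2|) z ^ 2 ∂(μ.prod μ)
      = 2 * ∫ x, T x ^ 2 ∂μ - 2 * (∫ x, T x ∂μ) ^ 2 := by
    have e : (fun z : Ω × Ω => |T z.1 - T z.2| ^ 2)
        = fun z => T z.1 ^ 2 + T z.2 ^ 2 - 2 * (T z.1 * T z.2) := by
      funext z; rw [sq_abs]; ring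
    have i1 : Integrable (fun z : Ω × Ω => T z.1 ^ 2) (μ.prod μ) := (hT2.integrable_sq).comp_fst μ
    have i2 : Integrable (fun z : Ω × Ω => T z.2 ^ 2) (μ.prod μ) := (hT2.integrable_sq).comp_snd μ
    have i3 : Integrable (fun z : Ω × Ω => 2 * (T z.1 * T z.2)) (μ.prod μ) :=
      (hTi.mul_prod hTi).const_mul 2
    have i12 : Integrable (fun z : Ω × Ω => T z.1 ^ 2 + T z.2 ^ 2) (μ.prod μ) := i1.add i2
    simp only
    rw [e, integral_sub i12 i3, integral_add i1 i2, integral_const_mul,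
      integral_fun_fst (fun x => T x ^ 2), integral_fun_snd (fun x => T x ^ 2),
      integral_prod_mul (fun x => T x) (fun x => T x), probReal_univ, one_smul]
    ring
  rw [integral_prod _ hDi] at hvar
  rw [variance_eq_sub hT2]
  simp only [Pi.pow_apply] at hvar hsq ⊢
  nlinarith [hvar, hsq]

omit hTm in
/-- Readable form: **`½·∫∫|T x − T y| dμ dμ ≤ √(Var_μ(T)/2)`**. [ours] -/
theorem half_integral_abs_sub_le_sqrt_variance :
    1 / 2 * ∫ x, ∫ y, |T x - T y| ∂μ ∂μ ≤ Real.sqrt (variance T μ / 2) := by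
  have h := sq_integral_abs_sub_le_two_mul_variance (μ := μ) hr hint
  have h0 : 0 ≤ ∫ x, ∫ y, |T x - T y| ∂μ ∂μ :=
    integral_nonneg fun x => integral_nonneg fun y => abs_nonneg _
  rw [show 1 / 2 * ∫ x, ∫ y, |T x - T y| ∂μ ∂μ = Real.sqrt ((∫ x, ∫ y, |T x - T y| ∂μ ∂μ) ^ 2 / 4) by
    rw [Real.sqrt_div' _ (by norm_num : (0 : ℝ) ≤ 4), Real.sqrt_sq h0, show Real.sqrt 4 = 2 by
      rw [show (4 : ℝ) = 2 ^ 2 by norm_num, Real.sqrt_sq (by norm_num)]]; ring]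
  exact Real.sqrt_le_sqrt (by linarith)

end Tilt

/-! ## §2 Wilson lattice gauge theory: slope = half the Gini mean difference of the action -/

section Wilson

open Literature.MathematicalPhysics.QuantumFieldTheory

variable {d L N : ℕ} [NeZero L] {G : Type*} [Group G] [TopologicalSpace G] [IsTopologicalGroup G]
  [CompactSpace G] [MeasurableSpace G] [BorelSpace G] (ρ : G →* Matrix (Fin N) (Fin N) ℂ)
  (μ : Measure (GaugeConfig d L G)) [IsProbabilityMeasure μ]

/-- **STRONG-COUPLING LAW OF THE UNTRAINED WILSON SAMPLER'S ACCEPTANCE**: for every compact `G`,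
continuous `ρ`, `d`, `L` and reference probability law `μ`,
`(1 − acc(β))/β → ½·∫∫ |S(U) − S(U′)| dμ dμ` as `β → 0⁺` (the acceptance of
`Scaling/WilsonIdentityFlowLaw.wilsonIdentityFlow_meanAccept_mem_Icc`). [ours] -/
theorem wilsonIdentityFlow_one_sub_meanAccept_div_tendsto (hρ : Continuous ρ) :
    Tendsto (fun β : ℝ => (1 - ∫ U, ∫ U',
        min (Real.exp (-β * wilsonAction ρ U) / ∫ V, Real.exp (-β * wilsonAction ρ V) ∂μ)
          (Real.exp (-β * wilsonAction ρ U') / ∫ V, Real.exp (-β * wilsonAction ρ V) ∂μ) ∂μ ∂μ) / β)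
      (𝓝[>] 0) (𝓝 (1 / 2 * ∫ U, ∫ U', |wilsonAction ρ U - wilsonAction ρ U'| ∂μ ∂μ)) := by
  have hint : ∀ γ : ℝ, Integrable (fun U : GaugeConfig d L G =>
      Real.exp (γ * -wilsonAction ρ U)) μ := fun γ => by
    simpa only [mul_neg, neg_mul] using integrable_exp_mul_wilsonAction ρ hρ (-γ) μ
  have h := tiltIMH_one_sub_meanAccept_div_tendsto (μ := μ) (T := fun U => -wilsonAction ρ U)
    (WilsonRP.measurable_wilsonAction ρ hρ).neg one_pos (fun γ _ => hint γ)
  simp only [neg_sub_neg] at h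
  have e : ∫ U, ∫ U', |wilsonAction ρ U' - wilsonAction ρ U| ∂μ ∂μ
      = ∫ U, ∫ U', |wilsonAction ρ U - wilsonAction ρ U'| ∂μ ∂μ := by
    simp_rw [abs_sub_comm (wilsonAction ρ _) (wilsonAction ρ _)]
  refine (e ▸ h).congr' (Eventually.of_forall fun β => ?_)
  simp only [wilsonIdentityFlow_meanAccept_eq_ratio ρ μ hρ, one_mul]

/-- **Product-Haar proposals** (the cell's identity flow; normalisation by `partitionFunction ρ β`):
`(1 − acc(β))/β → ½·∫∫ |S(U) − S(U′)| dHaar^{⊗E} dHaar^{⊗E}`. [ours] -/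
theorem wilsonIdentityFlow_one_sub_meanAccept_div_tendsto_haar (hρ : Continuous ρ) :
    Tendsto (fun β : ℝ => (1 - ∫ U, ∫ U',
        min (Real.exp (-β * wilsonAction ρ U) / (partitionFunction (d := d) (L := L) ρ β).toReal)
          (Real.exp (-β * wilsonAction ρ U') / (partitionFunction (d := d) (L := L) ρ β).toReal)
        ∂(Measure.pi fun _ : Edge d L => haarProbability G)
        ∂(Measure.pi fun _ : Edge d L => haarProbability G)) / β)
      (𝓝[>] 0) (𝓝 (1 / 2 * ∫ U, ∫ U', |wilsonAction ρ U - wilsonAction ρ U'|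
        ∂(Measure.pi fun _ : Edge d L => haarProbability G)
        ∂(Measure.pi fun _ : Edge d L => haarProbability G))) := by
  simp_rw [partitionFunction_toReal_eq_integral ρ hρ]
  exact wilsonIdentityFlow_one_sub_meanAccept_div_tendsto ρ _ hρ

end Wilson

/-! ## §3 The factorised 2-d U(1) model: slope = half the Gini mean difference of `Σᵢ cos θᵢ`
under the product Haar law -/

section U1

open Finset
open Summit.Ventures.LatticeQCDFlow.Scoring (onePlaquetteZ onePlaquetteZ_pos)

variable {ι : Type*} [Fintype ι]

/-- The product Haar PROBABILITY law on `(0, 2π]^V`, written as the rescaling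
`(2π)^{−V} • Lebesgue^{⊗V}`, is a probability measure. [folklore] -/
theorem u1Uniform_isProbabilityMeasure :
    IsProbabilityMeasure ((ENNReal.ofReal (∏ _i : ι, (1 / (2 * π) : ℝ)))
      • Measure.pi fun _ : ι => volume.restrict (Ioc (0 : ℝ) (2 * π))) := by
  constructor
  rw [Measure.smul_apply, Measure.pi_univ, smul_eq_mul]
  simp_rw [Measure.restrict_apply_univ, Real.volume_Ioc, sub_zero]
  rw [prod_const, prod_const, card_univ, ← ENNReal.ofReal_pow (by positivity),
    ← ENNReal.ofReal_mul (by positivity), ← mul_pow,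
    one_div_mul_cancel (by positivity : (2 * π : ℝ) ≠ 0), one_pow, ENNReal.ofReal_one]

/-- The U(1) `V`-plaquette acceptance of `Scaling/U1IdentityFlowVolumeLaw` as the acceptance of
product-Haar proposals against the tilt by `β·Σᵢ cos θᵢ` (probability normalisation). [ours] -/
theorem u1IdentityFlow_meanAccept_eq_uniform (β : ℝ) :
    ∫ x, ∫ x', min ((∏ i : ι, Real.exp (β * Real.cos (x i)) / onePlaquetteZ β)
          * ∏ _i : ι, (1 / (2 * π) : ℝ))
        ((∏ i : ι, Real.exp (β * Real.cos (x' i)) / onePlaquetteZ β) * ∏ _i : ι, (1 / (2 * π) : ℝ))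
        ∂(Measure.pi fun _ : ι => volume.restrict (Ioc (0 : ℝ) (2 * π)))
        ∂(Measure.pi fun _ : ι => volume.restrict (Ioc (0 : ℝ) (2 * π)))
      = (∫ x, ∫ x', min (Real.exp (β * ∑ i, Real.cos (x i))) (Real.exp (β * ∑ i, Real.cos (x' i)))
          ∂((ENNReal.ofReal (∏ _i : ι, (1 / (2 * π) : ℝ)))
            • Measure.pi fun _ : ι => volume.restrict (Ioc (0 : ℝ) (2 * π)))
          ∂((ENNReal.ofReal (∏ _i : ι, (1 / (2 * π) : ℝ)))
            • Measure.pi fun _ : ι => volume.restrict (Ioc (0 : ℝ) (2 * π))))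
        / ∫ x, Real.exp (β * ∑ i, Real.cos (x i))
          ∂((ENNReal.ofReal (∏ _i : ι, (1 / (2 * π) : ℝ)))
            • Measure.pi fun _ : ι => volume.restrict (Ioc (0 : ℝ) (2 * π))) := by
  have hq0 : 0 ≤ ∏ _i : ι, (1 / (2 * π) : ℝ) := prod_nonneg fun _ _ => by positivity
  rw [u1IdentityFlow_meanAccept_eq_ratio β]
  simp_rw [integral_smul_measure, smul_eq_mul, ENNReal.toReal_ofReal hq0, mul_assoc,
    integral_const_mul]

/-- **STRONG-COUPLING LAW OF THE UNTRAINED U(1) SAMPLER'S ACCEPTANCE**: for every finite plaquette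
set, `(1 − acc_V(β))/β → ½·(2π)^{−2V}∫∫ |Σᵢ cos θᵢ − Σᵢ cos θ′ᵢ| dθ dθ′` as `β → 0⁺` — half the Gini
mean difference of the total plaquette cosine under product Haar. [ours] -/
theorem u1IdentityFlow_one_sub_meanAccept_div_tendsto :
    Tendsto (fun β : ℝ => (1 - ∫ x, ∫ x',
        min ((∏ i : ι, Real.exp (β * Real.cos (x i)) / onePlaquetteZ β) * ∏ _i : ι, (1 / (2 * π) : ℝ))
          ((∏ i : ι, Real.exp (β * Real.cos (x' i)) / onePlaquetteZ β) * ∏ _i : ι, (1 / (2 * π) : ℝ))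
        ∂(Measure.pi fun _ : ι => volume.restrict (Ioc (0 : ℝ) (2 * π)))
        ∂(Measure.pi fun _ : ι => volume.restrict (Ioc (0 : ℝ) (2 * π)))) / β)
      (𝓝[>] 0) (𝓝 (1 / 2 * ((∏ _i : ι, (1 / (2 * π) : ℝ)) ^ 2
        * ∫ x, ∫ x', |∑ i, Real.cos (x i) - ∑ i, Real.cos (x' i)|
          ∂(Measure.pi fun _ : ι => volume.restrict (Ioc (0 : ℝ) (2 * π)))
          ∂(Measure.pi fun _ : ι => volume.restrict (Ioc (0 : ℝ) (2 * π)))))) := by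
  have hq0 : 0 ≤ ∏ _i : ι, (1 / (2 * π) : ℝ) := prod_nonneg fun _ _ => by positivity
  haveI : IsProbabilityMeasure ((ENNReal.ofReal (∏ _i : ι, (1 / (2 * π) : ℝ)))
      • Measure.pi fun _ : ι => volume.restrict (Ioc (0 : ℝ) (2 * π))) :=
    u1Uniform_isProbabilityMeasure
  obtain ⟨hTm, -, -⟩ := u1IdentityFlow_tilt_facts (ι := ι)
  have hint : ∀ γ : ℝ, Integrable (fun x : ι → ℝ => Real.exp (γ * ∑ i, Real.cos (x i)))
      ((ENNReal.ofReal (∏ _i : ι, (1 / (2 * π) : ℝ)))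
      • Measure.pi fun _ : ι => volume.restrict (Ioc (0 : ℝ) (2 * π))) := fun γ => by
    have h1 : Integrable (fun x : ι → ℝ => ∏ i, Real.exp (γ * Real.cos (x i))) (Measure.pi fun _ : ι => volume.restrict (Ioc (0 : ℝ) (2 * π))) :=
      Integrable.fintype_prod_dep (μ := fun _ : ι => volume.restrict (Ioc (0 : ℝ) (2 * π)))
        fun _ => integrableOn_exp_mul_cos γ
    exact (h1.congr (ae_of_all _ fun x => by simp only; rw [mul_sum, Real.exp_sum])).smul_measure
      ENNReal.ofReal_ne_top
  have h := tiltIMH_one_sub_meanAccept_div_tendsto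
    (μ := ((ENNReal.ofReal (∏ _i : ι, (1 / (2 * π) : ℝ)))
      • Measure.pi fun _ : ι => volume.restrict (Ioc (0 : ℝ) (2 * π))))
    (T := fun x : ι → ℝ => ∑ i, Real.cos (x i)) hTm one_pos (fun γ _ => hint γ)
  have hconst : 1 / 2 * ∫ x, ∫ x', |∑ i, Real.cos (x i) - ∑ i, Real.cos (x' i)|
      ∂((ENNReal.ofReal (∏ _i : ι, (1 / (2 * π) : ℝ)))
      • Measure.pi fun _ : ι => volume.restrict (Ioc (0 : ℝ) (2 * π)))
      ∂((ENNReal.ofReal (∏ _i : ι, (1 / (2 * π) : ℝ)))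
      • Measure.pi fun _ : ι => volume.restrict (Ioc (0 : ℝ) (2 * π)))
      = 1 / 2 * ((∏ _i : ι, (1 / (2 * π) : ℝ)) ^ 2
        * ∫ x, ∫ x', |∑ i, Real.cos (x i) - ∑ i, Real.cos (x' i)| ∂(Measure.pi fun _ : ι => volume.restrict (Ioc (0 : ℝ) (2 * π))) ∂(Measure.pi fun _ : ι => volume.restrict (Ioc (0 : ℝ) (2 * π)))) := by
    simp_rw [integral_smul_measure, smul_eq_mul, ENNReal.toReal_ofReal hq0, integral_const_mul]
    ring
  rw [hconst] at h
  refine h.congr' (Eventually.of_forall fun β => ?_)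
  beta_reduce
  rw [u1IdentityFlow_meanAccept_eq_uniform β]

end U1

end Summit.Ventures.LatticeQCDFlow.Theory2
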